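import Mathlib
import Literature.NumberTheory.LFunctions.ZetaZeros
import Summits.RiemannHypothesis.RiemannHypothesis.Theses.DensityLadder
import HarnessLib

/-!
# `DensityLadder` — LINE L57 «sieve sight above the density line»: the glue K1 → K2 → C

Items (route `route-RiemannHypothesis-DensityLadder`, filed by `workitem add` 2026-08-28, rh-idea-10 g1):
* K1 = stmt-RiemannHypothesis-24918 `SeparatedTowerDensityLine` (crux; RH-free, ζ-free model theorem),
* K2 = stmt-RiemannHypothesis-24919 `ZetaIntegerPrimeConsistent` (support; literature port, IK Thm 5.12),
* C  = stmt-RiemannHypothesis-24920 `ZetaSeparatedTowerBelowDensityLine` (support; the ζ target).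

The glue `K1 → K2 → C` is pure logic (instantiate the model theorem K1 at ζ's zero data, which K2
certifies).  At the time of writing the three decls are not yet rendered in
`Theses/DensityLadder.lean`, so the glue is stated here against the items' signatures VERBATIM
(`--supports stmt-RiemannHypothesis-24920`); the by-name one-liner
`zetaSeparatedTowerBelowDensityLine_of` is appended once the gate renders the decls.
Cell rh-split, seat rh-split-prover-l57 g0.  FRONTIER bookkeeping, DH-capped; nothing here bears on
the truth of RH.
-/

set_option linter.dupNamespace false  -- the mandated namespace repeats `RiemannHypothesis`

noncomputable section

namespace Summit.RiemannHypothesis.RiemannHypothesis.Theorems.DensityLadderSeparatedTowerGlue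

/-- **Glue of line L57 (unfolded form)**: the model theorem K1 (`SeparatedTowerDensityLine`,
stmt-RiemannHypothesis-24918, first binder, verbatim) applied to ζ's non-trivial zeros with their
orders and the von Mangoldt weight, whose hypotheses K2 (`ZetaIntegerPrimeConsistent`,
stmt-RiemannHypothesis-24919, second binder, verbatim) certifies, yields C
(`ZetaSeparatedTowerBelowDensityLine`, stmt-RiemannHypothesis-24920, the conclusion, verbatim).
Pure logic. [folklore] -/
theorem zetaSeparatedTowerBelowDensityLine_of_unfolded
    (h1 : ∀ (ι : Type) (m : ι → ℝ) (ρ : ι → ℂ) (w : ℕ → ℝ) (β e g : ℝ), 1 / 2 < β → β < 1 → 0 < g →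
    ((∃ B : ℝ, ∀ n : ℕ, 0 ≤ w n ∧ w n ≤ B * Real.log ((n : ℝ) + 2)) ∧
      (∀ φ : ℝ → ℝ, ContDiff ℝ 2 φ → (∀ v, 0 ≤ φ v) → (∀ v, 1 ≤ |v| → φ v = 0) →
        ∃ Cφ : ℝ, ∀ η x : ℝ, 0 < η → η ≤ 1 / 2 → 3 ≤ x →
          Summable (fun i : ι ↦ m i * ‖(x : ℂ) ^ (ρ i) *
            ∫ v in (-1 : ℝ)..1, (φ v : ℂ) * ((1 : ℂ) + (η : ℂ) * (v : ℂ)) ^ (ρ i - 1)‖) ∧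
          |(∑' n : ℕ, w n * φ (((n : ℝ) / x - 1) / η)) - η * x * (∫ v in (-1 : ℝ)..1, φ v)
              + η * (∑' i : ι, (m i : ℂ) * ((x : ℂ) ^ (ρ i) *
                ∫ v in (-1 : ℝ)..1, (φ v : ℂ) * ((1 : ℂ) + (η : ℂ) * (v : ℂ)) ^ (ρ i - 1))).re|
            ≤ Cφ * Real.log x)) →
    ((∃ C : ℝ, ∀ T : ℝ, {i : ι | (ρ i).re ≤ 1 / 2 ∧ |(ρ i).im - T| ≤ 1}.Finite ∧
        (∑ᶠ i ∈ {i : ι | (ρ i).re ≤ 1 / 2 ∧ |(ρ i).im - T| ≤ 1}, m i) ≤ C * Real.log (|T| + 2)) ∧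
      (∀ i : ι, 0 ≤ m i) ∧ (∀ i : ι, (ρ i).re ≤ 1 / 2 → 0 ≤ (ρ i).re) ∧
      (∃ σ : ι → ι, ∀ i : ι, σ (σ i) = i ∧ ρ (σ i) = (starRingEnd ℂ) (ρ i) ∧ m (σ i) = m i)) →
    ((∃ B : ℝ, ∀ i : ι, 1 / 2 < (ρ i).re → (ρ i).re < β ∧ 1 ≤ m i ∧ m i ≤ B) ∧
      (∀ β' : ℝ, β' < β → {i : ι | 1 / 2 < (ρ i).re ∧ (ρ i).re ≤ β'}.Finite) ∧
      (∀ i j : ι, 1 / 2 < (ρ i).re → 1 / 2 < (ρ j).re → i ≠ j → g ≤ |(ρ i).im - (ρ j).im|) ∧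
      (∃ c T₀ : ℝ, 0 < c ∧ ∀ T : ℝ, T₀ ≤ T →
        c * T ^ e ≤ ({i : ι | 1 / 2 < (ρ i).re ∧ |(ρ i).im| ≤ T}.ncard : ℝ))) →
    e ≤ 2 * (1 - β))
    (h2 : ((∃ B : ℝ, ∀ n : ℕ, 0 ≤ (fun n : ℕ ↦ ArithmeticFunction.vonMangoldt n) n ∧ (fun n : ℕ ↦ ArithmeticFunction.vonMangoldt n) n ≤ B * Real.log ((n : ℝ) + 2)) ∧
      (∀ φ : ℝ → ℝ, ContDiff ℝ 2 φ → (∀ v, 0 ≤ φ v) → (∀ v, 1 ≤ |v| → φ v = 0) →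
        ∃ Cφ : ℝ, ∀ η x : ℝ, 0 < η → η ≤ 1 / 2 → 3 ≤ x →
          Summable (fun i : ↥Literature.NumberTheory.LFunctions.ZetaZeros.riemannZetaNontrivialZeros ↦ (fun z : ↥Literature.NumberTheory.LFunctions.ZetaZeros.riemannZetaNontrivialZeros ↦ (Literature.NumberTheory.LFunctions.riemannZetaZeroOrder (z : ℂ) : ℝ)) i * ‖(x : ℂ) ^ ((fun z : ↥Literature.NumberTheory.LFunctions.ZetaZeros.riemannZetaNontrivialZeros ↦ (z : ℂ)) i) *
            ∫ v in (-1 : ℝ)..1, (φ v : ℂ) * ((1 : ℂ) + (η : ℂ) * (v : ℂ)) ^ ((fun z : ↥Literature.NumberTheory.LFunctions.ZetaZeros.riemannZetaNontrivialZeros ↦ (z : ℂ)) i - 1)‖) ∧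
          |(∑' n : ℕ, (fun n : ℕ ↦ ArithmeticFunction.vonMangoldt n) n * φ (((n : ℝ) / x - 1) / η)) - η * x * (∫ v in (-1 : ℝ)..1, φ v)
              + η * (∑' i : ↥Literature.NumberTheory.LFunctions.ZetaZeros.riemannZetaNontrivialZeros, ((fun z : ↥Literature.NumberTheory.LFunctions.ZetaZeros.riemannZetaNontrivialZeros ↦ (Literature.NumberTheory.LFunctions.riemannZetaZeroOrder (z : ℂ) : ℝ)) i : ℂ) * ((x : ℂ) ^ ((fun z : ↥Literature.NumberTheory.LFunctions.ZetaZeros.riemannZetaNontrivialZeros ↦ (z : ℂ)) i) *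
                ∫ v in (-1 : ℝ)..1, (φ v : ℂ) * ((1 : ℂ) + (η : ℂ) * (v : ℂ)) ^ ((fun z : ↥Literature.NumberTheory.LFunctions.ZetaZeros.riemannZetaNontrivialZeros ↦ (z : ℂ)) i - 1))).re|
            ≤ Cφ * Real.log x)) ∧
    ((∃ C : ℝ, ∀ T : ℝ, {i : ↥Literature.NumberTheory.LFunctions.ZetaZeros.riemannZetaNontrivialZeros | ((fun z : ↥Literature.NumberTheory.LFunctions.ZetaZeros.riemannZetaNontrivialZeros ↦ (z : ℂ)) i).re ≤ 1 / 2 ∧ |((fun z : ↥Literature.NumberTheory.LFunctions.ZetaZeros.riemannZetaNontrivialZeros ↦ (z : ℂ)) i).im - T| ≤ 1}.Finite ∧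
        (∑ᶠ i ∈ {i : ↥Literature.NumberTheory.LFunctions.ZetaZeros.riemannZetaNontrivialZeros | ((fun z : ↥Literature.NumberTheory.LFunctions.ZetaZeros.riemannZetaNontrivialZeros ↦ (z : ℂ)) i).re ≤ 1 / 2 ∧ |((fun z : ↥Literature.NumberTheory.LFunctions.ZetaZeros.riemannZetaNontrivialZeros ↦ (z : ℂ)) i).im - T| ≤ 1}, (fun z : ↥Literature.NumberTheory.LFunctions.ZetaZeros.riemannZetaNontrivialZeros ↦ (Literature.NumberTheory.LFunctions.riemannZetaZeroOrder (z : ℂ) : ℝ)) i) ≤ C * Real.log (|T| + 2)) ∧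
      (∀ i : ↥Literature.NumberTheory.LFunctions.ZetaZeros.riemannZetaNontrivialZeros, 0 ≤ (fun z : ↥Literature.NumberTheory.LFunctions.ZetaZeros.riemannZetaNontrivialZeros ↦ (Literature.NumberTheory.LFunctions.riemannZetaZeroOrder (z : ℂ) : ℝ)) i) ∧ (∀ i : ↥Literature.NumberTheory.LFunctions.ZetaZeros.riemannZetaNontrivialZeros, ((fun z : ↥Literature.NumberTheory.LFunctions.ZetaZeros.riemannZetaNontrivialZeros ↦ (z : ℂ)) i).re ≤ 1 / 2 → 0 ≤ ((fun z : ↥Literature.NumberTheory.LFunctions.ZetaZeros.riemannZetaNontrivialZeros ↦ (z : ℂ)) i).re) ∧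
      (∃ σ : ↥Literature.NumberTheory.LFunctions.ZetaZeros.riemannZetaNontrivialZeros → ↥Literature.NumberTheory.LFunctions.ZetaZeros.riemannZetaNontrivialZeros, ∀ i : ↥Literature.NumberTheory.LFunctions.ZetaZeros.riemannZetaNontrivialZeros, σ (σ i) = i ∧ (fun z : ↥Literature.NumberTheory.LFunctions.ZetaZeros.riemannZetaNontrivialZeros ↦ (z : ℂ)) (σ i) = (starRingEnd ℂ) ((fun z : ↥Literature.NumberTheory.LFunctions.ZetaZeros.riemannZetaNontrivialZeros ↦ (z : ℂ)) i) ∧ (fun z : ↥Literature.NumberTheory.LFunctions.ZetaZeros.riemannZetaNontrivialZeros ↦ (Literature.NumberTheory.LFunctions.riemannZetaZeroOrder (z : ℂ) : ℝ)) (σ i) = (fun z : ↥Literature.NumberTheory.LFunctions.ZetaZeros.riemannZetaNontrivialZeros ↦ (Literature.NumberTheory.LFunctions.riemannZetaZeroOrder (z : ℂ) : ℝ)) i))) :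
    ∀ β e g : ℝ, 1 / 2 < β → β < 1 → 0 < g →
    ((∃ B : ℝ, ∀ i : ↥Literature.NumberTheory.LFunctions.ZetaZeros.riemannZetaNontrivialZeros, 1 / 2 < ((fun z : ↥Literature.NumberTheory.LFunctions.ZetaZeros.riemannZetaNontrivialZeros ↦ (z : ℂ)) i).re → ((fun z : ↥Literature.NumberTheory.LFunctions.ZetaZeros.riemannZetaNontrivialZeros ↦ (z : ℂ)) i).re < β ∧ 1 ≤ (fun z : ↥Literature.NumberTheory.LFunctions.ZetaZeros.riemannZetaNontrivialZeros ↦ (Literature.NumberTheory.LFunctions.riemannZetaZeroOrder (z : ℂ) : ℝ)) i ∧ (fun z : ↥Literature.NumberTheory.LFunctions.ZetaZeros.riemannZetaNontrivialZeros ↦ (Literature.NumberTheory.LFunctions.riemannZetaZeroOrder (z : ℂ) : ℝ)) i ≤ B) ∧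
      (∀ β' : ℝ, β' < β → {i : ↥Literature.NumberTheory.LFunctions.ZetaZeros.riemannZetaNontrivialZeros | 1 / 2 < ((fun z : ↥Literature.NumberTheory.LFunctions.ZetaZeros.riemannZetaNontrivialZeros ↦ (z : ℂ)) i).re ∧ ((fun z : ↥Literature.NumberTheory.LFunctions.ZetaZeros.riemannZetaNontrivialZeros ↦ (z : ℂ)) i).re ≤ β'}.Finite) ∧
      (∀ i j : ↥Literature.NumberTheory.LFunctions.ZetaZeros.riemannZetaNontrivialZeros, 1 / 2 < ((fun z : ↥Literature.NumberTheory.LFunctions.ZetaZeros.riemannZetaNontrivialZeros ↦ (z : ℂ)) i).re → 1 / 2 < ((fun z : ↥Literature.NumberTheory.LFunctions.ZetaZeros.riemannZetaNontrivialZeros ↦ (z : ℂ)) j).re → i ≠ j → g ≤ |((fun z : ↥Literature.NumberTheory.LFunctions.ZetaZeros.riemannZetaNontrivialZeros ↦ (z : ℂ)) i).im - ((fun z : ↥Literature.NumberTheory.LFunctions.ZetaZeros.riemannZetaNontrivialZeros ↦ (z : ℂ)) j).im|) ∧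
      (∃ c T₀ : ℝ, 0 < c ∧ ∀ T : ℝ, T₀ ≤ T →
        c * T ^ e ≤ ({i : ↥Literature.NumberTheory.LFunctions.ZetaZeros.riemannZetaNontrivialZeros | 1 / 2 < ((fun z : ↥Literature.NumberTheory.LFunctions.ZetaZeros.riemannZetaNontrivialZeros ↦ (z : ℂ)) i).re ∧ |((fun z : ↥Literature.NumberTheory.LFunctions.ZetaZeros.riemannZetaNontrivialZeros ↦ (z : ℂ)) i).im| ≤ T}.ncard : ℝ))) →
    e ≤ 2 * (1 - β) :=
  fun β e g hβ hβ1 hg ht ↦ h1 _ _ _ _ β e g hβ hβ1 hg h2.1 h2.2 ht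

/-- **Glue of line L57, by name** (the route decls are rendered since 2026-08-28T03:36Z):
`SeparatedTowerDensityLine → ZetaIntegerPrimeConsistent → ZetaSeparatedTowerBelowDensityLine`
(items stmt-RiemannHypothesis-24918 → -24919 → -24920). Pure logic. [folklore] -/
theorem zetaSeparatedTowerBelowDensityLine_of
    (h1 : Summit.RiemannHypothesis.RiemannHypothesis.Theses.DensityLadder.SeparatedTowerDensityLine)
    (h2 : Summit.RiemannHypothesis.RiemannHypothesis.Theses.DensityLadder.ZetaIntegerPrimeConsistent) :
    Summit.RiemannHypothesis.RiemannHypothesis.Theses.DensityLadder.ZetaSeparatedTowerBelowDensityLine :=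
  zetaSeparatedTowerBelowDensityLine_of_unfolded h1 h2

/-- **C from K1 alone**: since K2 `ZetaIntegerPrimeConsistent` (stmt-RiemannHypothesis-24919) is
PROVED (`ZetaIntegerPrimeConsistent_holds`, from
`Theorems.DensityLadderZetaIntegerPrimeConsistent.zetaIntegerPrimeConsistent_unfolded`), the ζ target
`ZetaSeparatedTowerBelowDensityLine` (stmt-RiemannHypothesis-24920) now follows from the model theorem
`SeparatedTowerDensityLine` (stmt-RiemannHypothesis-24918) alone. RH-free. [folklore] -/
theorem zetaSeparatedTowerBelowDensityLine_of_separatedTowerDensityLine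
    (h1 : Summit.RiemannHypothesis.RiemannHypothesis.Theses.DensityLadder.SeparatedTowerDensityLine) :
    Summit.RiemannHypothesis.RiemannHypothesis.Theses.DensityLadder.ZetaSeparatedTowerBelowDensityLine :=
  zetaSeparatedTowerBelowDensityLine_of h1
    Summit.RiemannHypothesis.RiemannHypothesis.Theses.DensityLadder.ZetaIntegerPrimeConsistent_holds

end Summit.RiemannHypothesis.RiemannHypothesis.Theorems.DensityLadderSeparatedTowerGlue

end
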